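/-
HONEST FRAMING: certified error envelopes and provably optimal rounding/accumulation schemes for
low-precision formats under stated cost models; every table by two implementations; no hardware
or vendor claims.
-/
import Summits.Ventures.CertifiedArithmetic.LowPrec.OptDemotionRoutingMidconvex

/-!
# The demotion law (Theorem T8), part 10d: opt's GAP CONVEXITY (R28)

opt gen 15 (gen15/README §2, OPTIMA.md T8 (R28); proves gen 14's conjecture R27 = the case
`S = {top bit}`).  **THEOREM (every tree, every precision).**  Let `S` be a configuration of bits
and `m₁ < m₂ < m₃` positions outside `S` in ONE GAP of `S` (no bit of `S` between `m₁` and `m₃`),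
with `S ∪ {mᵢ}` routable.  Then `m ↦ BR_t(S ∪ {m})` is convex in the VALUE `2^m` of the moving
bit on that gap:
`(2^m₃ - 2^m₁) · BR_t(S ∪ {m₂}) ≤ (2^m₃ - 2^m₂) · BR_t(S ∪ {m₁}) + (2^m₂ - 2^m₁) · BR_t(S ∪ {m₃})`
(`treeBR_gap_convex`), and with the lower position absent (`S` entirely above `m₃`):
`2^m₃ · BR_t(S ∪ {m₂}) ≤ (2^m₃ - 2^m₂) · BR_t(S) + 2^m₂ · BR_t(S ∪ {m₃})` (`treeBR_gap_convex₀`).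
PROOF (opt's family form, in the language of parts 8f–8h): take a supporting routing `G` of
`S ∪ {m₂}` at the actual weight (`exists_isCoef_support`); its score is affine in the weight of the
family of `m₂` (`score_add_weight`); transplanting that family to `m₃` or to `m₁` keeps the routing
valid because the ORDER of the bits is unchanged in one gap (part 8g `treeBRw_le_transplant`), and
deleting it is part 8b; the three lower bounds combine with the weights
`λ₁ = (2^m₃ - 2^m₂)/(2^m₃ - 2^m₁)`, `λ₃ = (2^m₂ - 2^m₁)/(2^m₃ - 2^m₁)` to the score of `G`.  The
midpoint-convexity rows (MC) of part 8h are the case of a run of length one; R28 rows are LP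
hypotheses of opt's cone closures (gen15 r28_q*.json); cross-gap rows are false (gen15 §2).
-/

namespace Summit.Ventures.CertifiedArithmetic.LowPrec.Opt

open Literature.ComputerArithmetic.JeannerodRump2018
open Literature.ComputerArithmetic.JeannerodRump2018.SumTree

section GapConvex

variable {q : ℕ}

/-- THE ONE-BIT TRANSPLANT BOUND: for a routable `S₂ = S ∪ {m₂}` (`m₂ ∉ S`), a free position
`m' ∉ S`, `m' ≠ m₂`, on the same side of every bit of `S` as `m₂`, with `S ∪ {m'}` routable, and a
coefficient vector `G` supported by `S₂` (its score at every weight is a lower bound for the value):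
`score(2^·) G - T + 2^(m' - m₂) · T ≤ BR_t(S ∪ {m'})`, `T` the score of the family of `m₂`. -/
theorem score_transplant_le (t : SumTree) {S : Finset ℤ} {m₂ m' : ℤ} (hm₂ : m₂ ∉ S) (hm' : m' ∉ S)
    (hne : m' ≠ m₂) (hS₂ : Routable q (insert m₂ S)) (hS' : Routable q (insert m' S))
    (hside : ∀ s ∈ S, m₂ < s ↔ m' < s) {G : ℤ →₀ ℚ}
    (hsupp : ∀ W' : ℤ → ℚ, score W' G ≤ treeBRw q W' t (insert m₂ S)) :
    score (fun e => (2 : ℚ) ^ e) G - score (classW q m₂) G +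
        (2 : ℚ) ^ (m' - m₂) * score (classW q m₂) G ≤ treeBR q t (insert m' S) := by
  classical
  set S₂ := insert m₂ S with hS₂def
  set d : ℤ := m' - m₂ with hd
  have h2pos : ∀ e : ℤ, (0 : ℚ) < (2 : ℚ) ^ e := fun e => zpow_pos (by norm_num) e
  have hm₂S₂ : m₂ ∈ S₂ := Finset.mem_insert_self _ _
  -- the weight: actual off the class of m₂, the class of m₂ paid at the rate of m'
  set Wd : ℤ → ℚ := fun e => (2 : ℚ) ^ e - classW q m₂ e + (2 : ℚ) ^ d * classW q m₂ e with hWd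
  have hWd_on : ∀ e, (q : ℤ) ∣ e - m₂ → Wd e = (2 : ℚ) ^ (e + d) := fun e he => by
    rw [hWd]; simp only; unfold classW; rw [if_pos he, zpow_add₀ (by norm_num)]; ring
  have hWd_off : ∀ e, ¬ (q : ℤ) ∣ e - m₂ → Wd e = (2 : ℚ) ^ e := fun e he => by
    rw [hWd]; simp only; unfold classW; rw [if_neg he]; ring
  -- its score
  have hsc : score Wd G = score (fun e => (2 : ℚ) ^ e) G - score (classW q m₂) G +
      (2 : ℚ) ^ d * score (classW q m₂) G := by
    have e1 : Wd = fun e => ((2 : ℚ) ^ e + (-1) * classW q m₂ e) + (2 : ℚ) ^ d * classW q m₂ e := by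
      funext e; rw [hWd]; simp only; ring
    rw [e1, score_add_weight, score_add_weight, score_smul_weight, score_smul_weight]; ring
  -- the transplant of the class of m₂ to the class of m'
  have hOK : TransplantOK q S₂ m₂ d := by
    refine ⟨hS₂, hm₂S₂, ?_, ?_, ?_⟩
    · rw [hd, show m₂ + (m' - m₂) = m' by ring]
      intro h
      rcases Finset.mem_insert.1 h with h | h
      · exact hne h
      · exact hm' h
    · rw [hd, show m₂ + (m' - m₂) = m' by ring, hS₂def, Finset.erase_insert hm₂]
      exact hS'
    · intro e he hne'
      rw [hd, show m₂ + (m' - m₂) = m' by ring]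
      rcases Finset.mem_insert.1 he with h | h
      · exact absurd h hne'
      · exact hside e h
  have hWW : ∀ x, InD q S₂ x → Wd x ≤ (2 : ℚ) ^ (transplant q m₂ d x) := by
    intro x _
    unfold transplant
    by_cases h : (q : ℤ) ∣ x - m₂
    · rw [if_pos h, hWd_on x h]
    · rw [if_neg h, hWd_off x h]
  -- the image of S₂ is S ∪ {m'}
  have himg : S₂.image (transplant q m₂ d) = insert m' S := by
    rw [hS₂def, Finset.image_insert]
    have e1 : transplant q m₂ d m₂ = m' := by unfold transplant; rw [if_pos (by simp), hd]; ring
    rw [e1]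
    congr 1
    refine Finset.image_congr (g := id) (fun x hx => ?_) |>.trans Finset.image_id
    have hx' : x ∈ S := Finset.mem_coe.1 hx
    unfold transplant
    rw [if_neg]
    · rfl
    · intro h
      exact hm₂ ((eq_of_routable_of_dvd hS₂ (Finset.mem_insert_of_mem hx') hm₂S₂ h) ▸ hx')
  have htr := treeBRw_le_transplant hOK (W := Wd) (W' := fun e => (2 : ℚ) ^ e) hWW t S₂
    (fun x hx => inD_of_mem hx) hS₂
  rw [himg] at htr
  calc score (fun e => (2 : ℚ) ^ e) G - score (classW q m₂) G + (2 : ℚ) ^ d * score (classW q m₂) G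
      = score Wd G := hsc.symm
    _ ≤ treeBRw q Wd t S₂ := hsupp Wd
    _ ≤ treeBRw q (fun e => (2 : ℚ) ^ e) t (insert m' S) := htr
    _ = treeBR q t (insert m' S) := rfl

/-- THE DELETION BOUND: `score(2^·) G - T ≤ BR_t(S)` for a supporting `G` of `S ∪ {m₂}`. -/
theorem score_delete_le (t : SumTree) {S : Finset ℤ} {m₂ : ℤ} (hm₂ : m₂ ∉ S)
    (hS₂ : Routable q (insert m₂ S)) {G : ℤ →₀ ℚ}
    (hsupp : ∀ W' : ℤ → ℚ, score W' G ≤ treeBRw q W' t (insert m₂ S)) :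
    score (fun e => (2 : ℚ) ^ e) G - score (classW q m₂) G ≤ treeBR q t S := by
  classical
  have hm₂S₂ : m₂ ∈ insert m₂ S := Finset.mem_insert_self _ _
  set Wm : ℤ → ℚ := fun e => (2 : ℚ) ^ e - classW q m₂ e with hWm
  have hWm0 : ∀ e, 0 ≤ Wm e := fun e => by rw [hWm]; simp only; linarith [classW_le q m₂ e]
  have hWmnull : ∀ e, ¬ ¬ (q : ℤ) ∣ e - m₂ → Wm e = 0 := fun e he => by
    rw [hWm]; simp only; unfold classW; rw [if_pos (not_not.1 he)]; ring
  have hsc : score Wm G = score (fun e => (2 : ℚ) ^ e) G - score (classW q m₂) G := by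
    have := score_add_weight Wm (classW q m₂) G
    have e1 : (fun e => Wm e + classW q m₂ e) = fun e => (2 : ℚ) ^ e := by
      funext e; rw [hWm]; simp only; ring
    rw [e1] at this; linarith
  have hdel := treeBRw_le_filter (q := q) (W := Wm) hWm0 (p := fun e => ¬ (q : ℤ) ∣ e - m₂)
    (fun e => by rw [dvd_sub_shift_iff]) hWmnull t (insert m₂ S) hS₂
  have hfil : (insert m₂ S).filter (fun e => ¬ (q : ℤ) ∣ e - m₂) = S := by
    ext e
    simp only [Finset.mem_filter, Finset.mem_insert]
    constructor
    · rintro ⟨he | he, hne⟩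
      · exact absurd (by rw [he]; simp) hne
      · exact he
    · intro he
      refine ⟨Or.inr he, fun h => hm₂ ?_⟩
      exact (eq_of_routable_of_dvd hS₂ (Finset.mem_insert_of_mem he) hm₂S₂ h) ▸ he
  rw [hfil] at hdel
  have hloc : treeBRw q Wm t S = treeBR q t S := by
    rw [treeBR]
    refine treeBRw_congr (p := fun e => ∃ s ∈ S, (q : ℤ) ∣ e - s)
      (fun e ⟨s, hs, h⟩ => ⟨s, hs, (dvd_sub_shift_iff _ _ _).2 h⟩) (fun e ⟨s, hs, h⟩ => ?_)
      t _ (fun e he => ⟨e, he, by simp⟩)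
    rw [hWm]; simp only; unfold classW
    rw [if_neg, sub_zero]
    intro h'
    have : (q : ℤ) ∣ s - m₂ := by
      have := dvd_sub h' h; rwa [show e - m₂ - (e - s) = s - m₂ by ring] at this
    exact hm₂ ((eq_of_routable_of_dvd hS₂ (Finset.mem_insert_of_mem hs) hm₂S₂ this) ▸ hs)
  calc score (fun e => (2 : ℚ) ^ e) G - score (classW q m₂) G = score Wm G := hsc.symm
    _ ≤ treeBRw q Wm t (insert m₂ S) := hsupp Wm
    _ ≤ treeBRw q Wm t S := hdel
    _ = treeBR q t S := hloc

/-- **GAP CONVEXITY (opt R28)**, every tree, every precision: for a configuration `S` and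
positions `m₁ < m₂ < m₃` outside `S` with no bit of `S` between `m₁` and `m₃`, `S ∪ {mᵢ}` routable:
`(2^m₃ - 2^m₁) · BR_t(S ∪ {m₂}) ≤ (2^m₃ - 2^m₂) · BR_t(S ∪ {m₁}) + (2^m₂ - 2^m₁) · BR_t(S ∪ {m₃})`. -/
theorem treeBR_gap_convex (t : SumTree) {S : Finset ℤ} {m₁ m₂ m₃ : ℤ} (h12 : m₁ < m₂) (h23 : m₂ < m₃)
    (hm₁ : m₁ ∉ S) (hm₂ : m₂ ∉ S) (hm₃ : m₃ ∉ S) (hgap : ∀ s ∈ S, s < m₁ ∨ m₃ < s)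
    (hS₁ : Routable q (insert m₁ S)) (hS₂ : Routable q (insert m₂ S))
    (hS₃ : Routable q (insert m₃ S)) :
    ((2 : ℚ) ^ m₃ - (2 : ℚ) ^ m₁) * treeBR q t (insert m₂ S) ≤
      ((2 : ℚ) ^ m₃ - (2 : ℚ) ^ m₂) * treeBR q t (insert m₁ S) +
        ((2 : ℚ) ^ m₂ - (2 : ℚ) ^ m₁) * treeBR q t (insert m₃ S) := by
  have h2pos : ∀ e : ℤ, (0 : ℚ) < (2 : ℚ) ^ e := fun e => zpow_pos (by norm_num) e
  obtain ⟨G, hG, hGeq, hsupp⟩ := exists_isCoef_support (q := q) (W := fun e => (2 : ℚ) ^ e)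
    (fun e => (h2pos e).le) t hS₂
  have hside₁ : ∀ s ∈ S, m₂ < s ↔ m₁ < s := fun s hs => by
    rcases hgap s hs with h | h <;> constructor <;> intro <;> omega
  have hside₃ : ∀ s ∈ S, m₂ < s ↔ m₃ < s := fun s hs => by
    rcases hgap s hs with h | h <;> constructor <;> intro <;> omega
  have hlo := score_transplant_le t hm₂ hm₁ (by omega) hS₂ hS₁ hside₁ hsupp
  have hhi := score_transplant_le t hm₂ hm₃ (by omega) hS₂ hS₃ hside₃ hsupp
  set T := score (classW q m₂) G with hT
  have hT0 : 0 ≤ T := by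
    have := score_mono_weight (W₁ := fun _ => 0) (W₂ := classW q m₂) (isCoef_nonneg t _ G hG)
      (classW_nonneg q m₂)
    rwa [show score (fun _ => (0 : ℚ)) G = 0 by unfold score; simp] at this
  rw [treeBR, ← hGeq]
  -- weights: 2^(m₁-m₂) = 2^m₁/2^m₂, 2^(m₃-m₂) = 2^m₃/2^m₂
  have e1 : (2 : ℚ) ^ (m₁ - m₂) * (2 : ℚ) ^ m₂ = (2 : ℚ) ^ m₁ := by
    rw [← zpow_add₀ (by norm_num)]; congr 1; ring
  have e3 : (2 : ℚ) ^ (m₃ - m₂) * (2 : ℚ) ^ m₂ = (2 : ℚ) ^ m₃ := by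
    rw [← zpow_add₀ (by norm_num)]; congr 1; ring
  have hc1 : 0 ≤ (2 : ℚ) ^ m₃ - (2 : ℚ) ^ m₂ := by
    linarith [zpow_le_zpow_right₀ (by norm_num : (1 : ℚ) ≤ 2) h23.le]
  have hc3 : 0 ≤ (2 : ℚ) ^ m₂ - (2 : ℚ) ^ m₁ := by
    linarith [zpow_le_zpow_right₀ (by norm_num : (1 : ℚ) ≤ 2) h12.le]
  have k1 := mul_le_mul_of_nonneg_left hlo hc1
  have k3 := mul_le_mul_of_nonneg_left hhi hc3
  -- multiply everything by 2^m₂ > 0 to clear the ratios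
  have hm2 := h2pos m₂
  have key : (2 : ℚ) ^ m₂ * (((2 : ℚ) ^ m₃ - (2 : ℚ) ^ m₁) * score (fun e => (2 : ℚ) ^ e) G) ≤
      (2 : ℚ) ^ m₂ * (((2 : ℚ) ^ m₃ - (2 : ℚ) ^ m₂) * treeBR q t (insert m₁ S) +
        ((2 : ℚ) ^ m₂ - (2 : ℚ) ^ m₁) * treeBR q t (insert m₃ S)) := by
    have k1' := mul_le_mul_of_nonneg_left k1 hm2.le
    have k3' := mul_le_mul_of_nonneg_left k3 hm2.le
    have x1 : (2 : ℚ) ^ m₂ * ((2 : ℚ) ^ (m₁ - m₂) * T) = (2 : ℚ) ^ m₁ * T := by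
      rw [← mul_assoc, mul_comm ((2 : ℚ) ^ m₂), e1]
    have x3 : (2 : ℚ) ^ m₂ * ((2 : ℚ) ^ (m₃ - m₂) * T) = (2 : ℚ) ^ m₃ * T := by
      rw [← mul_assoc, mul_comm ((2 : ℚ) ^ m₂), e3]
    nlinarith [k1', k3', x1, x3, hT0, hm2]
  exact le_of_mul_le_mul_left key hm2

/-- **GAP CONVEXITY WITH THE LOWER POSITION ABSENT (opt R28, `m₁ = 0`)**: for `S` entirely above
`m₃ > m₂` (`m₂, m₃ ∉ S`), `S ∪ {m₂}`, `S ∪ {m₃}` routable: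
`2^m₃ · BR_t(S ∪ {m₂}) ≤ (2^m₃ - 2^m₂) · BR_t(S) + 2^m₂ · BR_t(S ∪ {m₃})`. -/
theorem treeBR_gap_convex₀ (t : SumTree) {S : Finset ℤ} {m₂ m₃ : ℤ} (h23 : m₂ < m₃)
    (hm₂ : m₂ ∉ S) (hm₃ : m₃ ∉ S) (hgap : ∀ s ∈ S, m₃ < s)
    (hS₂ : Routable q (insert m₂ S)) (hS₃ : Routable q (insert m₃ S)) :
    (2 : ℚ) ^ m₃ * treeBR q t (insert m₂ S) ≤
      ((2 : ℚ) ^ m₃ - (2 : ℚ) ^ m₂) * treeBR q t S + (2 : ℚ) ^ m₂ * treeBR q t (insert m₃ S) := by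
  have h2pos : ∀ e : ℤ, (0 : ℚ) < (2 : ℚ) ^ e := fun e => zpow_pos (by norm_num) e
  obtain ⟨G, hG, hGeq, hsupp⟩ := exists_isCoef_support (q := q) (W := fun e => (2 : ℚ) ^ e)
    (fun e => (h2pos e).le) t hS₂
  have hside₃ : ∀ s ∈ S, m₂ < s ↔ m₃ < s := fun s hs => by
    have := hgap s hs; constructor <;> intro <;> omega
  have hlo := score_delete_le t hm₂ hS₂ hsupp
  have hhi := score_transplant_le t hm₂ hm₃ (by omega) hS₂ hS₃ hside₃ hsupp
  set T := score (classW q m₂) G with hT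
  have hT0 : 0 ≤ T := by
    have := score_mono_weight (W₁ := fun _ => 0) (W₂ := classW q m₂) (isCoef_nonneg t _ G hG)
      (classW_nonneg q m₂)
    rwa [show score (fun _ => (0 : ℚ)) G = 0 by unfold score; simp] at this
  rw [treeBR, ← hGeq]
  have e3 : (2 : ℚ) ^ (m₃ - m₂) * (2 : ℚ) ^ m₂ = (2 : ℚ) ^ m₃ := by
    rw [← zpow_add₀ (by norm_num)]; congr 1; ring
  have hc1 : 0 ≤ (2 : ℚ) ^ m₃ - (2 : ℚ) ^ m₂ := by
    linarith [zpow_le_zpow_right₀ (by norm_num : (1 : ℚ) ≤ 2) h23.le]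
  have hm2 := h2pos m₂
  have k1 := mul_le_mul_of_nonneg_left hlo hc1
  have k3 := mul_le_mul_of_nonneg_left hhi hm2.le
  have x3 : (2 : ℚ) ^ m₂ * ((2 : ℚ) ^ (m₃ - m₂) * T) = (2 : ℚ) ^ m₃ * T := by
    rw [← mul_assoc, mul_comm ((2 : ℚ) ^ m₂), e3]
  nlinarith [k1, k3, x3, hT0]

end GapConvex

end Summit.Ventures.CertifiedArithmetic.LowPrec.Opt
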